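import Summits.Ventures.Crystal3D.Theorems.StickyWulffConstantNoReconstructionGainInterstitialGain
import HarnessLib

/-!
# The pooled (flow) form of the cap compensation rule

HONEST FRAMING. Part of the venture `Summits/Ventures/Crystal3D` (cell `crystal3d-full`), helper
`--supports` the crux `NoReconstructionGain` (stmt-Ventures-19144, route
`route-Ventures-StickyWulffConstant`), line `adhesion` (wulff-p1 g10); corollary of the gain bound
`interstitialGain_slab` (`…InterstitialGain`), companion of `…InterstitialRules`.

* `sum_sum_realTransfer_eq_zero` — a real antisymmetric transfer telescopes over the film;
* `pooledFilm_slab` (**rung**, `R = 2`, `C = 792`): if, off a rim set of at most `ρ` film balls,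
  the per-ball excess `a(q) − v(q)` (interstitial contacts below / level minus vacant registered
  down / level caps, as in `…InterstitialGain`) can be cancelled by an antisymmetric transfer of at
  most one unit along each film–film contact, the atom holds.  With the zero transfer this is the
  per-ball rule `compensatedFilm_slab`; in general it is the max-flow certificate in cap currency —
  any feasible flow found numerically for a film is a proof for that film (census j301510: the
  zero transfer already certifies 7949 of the 8037 R26 zoo films ball by ball, and every one of the
  8037 film totals).

WHAT THIS IS NOT: existence of the transfer for arbitrary films (that is the crux, in cap currency:
`Σ_q a(q) ≤ Σ_q v(q) + O(ρ)` hereditarily); rung F-C1 not moved.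
-/

noncomputable section

namespace Summit.Ventures.Crystal3D.Theorems

open Summit.Ventures.Crystal3D Finset
open Literature.MathematicalPhysics.StatisticalMechanics (fccStacking orderedContacts contactDeficiency)
open scoped InnerProductSpace

/-- A real antisymmetric transfer sums to zero over the (symmetric) film–film contact relation. -/
theorem sum_sum_realTransfer_eq_zero (Q : Finset (EuclideanSpace ℝ (Fin 3)))
    (w : EuclideanSpace ℝ (Fin 3) → EuclideanSpace ℝ (Fin 3) → ℝ) (hw : ∀ x y, w x y = -w y x) :
    ∑ q ∈ Q, ∑ x ∈ Q.filter (fun x => dist q x = 1), w x q = 0 := by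
  classical
  have key : ∀ q ∈ Q, ∑ x ∈ Q.filter (fun x => dist q x = 1), w x q =
      ∑ x ∈ Q, (if dist q x = 1 then w x q else 0) := fun q _ => by rw [sum_filter]
  rw [sum_congr rfl key]
  set S := ∑ q ∈ Q, ∑ x ∈ Q, (if dist q x = 1 then w x q else 0) with hS
  have hneg : S = -S := by
    conv_lhs => rw [hS, sum_comm]
    rw [hS, ← sum_neg_distrib]
    refine sum_congr rfl fun q _ => ?_
    rw [← sum_neg_distrib]
    refine sum_congr rfl fun x _ => ?_
    rw [dist_comm]
    split_ifs
    · rw [hw]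
    · simp
  linarith

/-- **The pooled (flow) form of the compensation rule implies the atom** (`R = 2`, `C = 792`;
registered by name on stmt-Ventures-19144).  If, off a rim set of at most `ρ` film balls, the
per-ball excess `a(q) − v(q)` can be cancelled by an antisymmetric transfer `w` of at most one unit
along each film–film contact (`a(q) + Σ_{x ∼ q} w x q ≤ v(q)`), then the atom holds.  With `w = 0`
this is `compensatedFilm_slab`; in general it is the max-flow certificate in cap currency (any
feasible flow found numerically on a film is a proof for that film). -/
theorem pooledFilm_slab :
    ∃ R C : ℝ, 1 ≤ R ∧ ∀ U : Finset (EuclideanSpace ℝ (Fin 3)),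
      (∀ d ∈ U, d ∈ fccStacking 1 (Real.sqrt (2 / 3)) ∧ ‖d‖ = 1) → (∀ d ∈ U, -d ∈ U) → U.card = 12 →
      ∀ ν : EuclideanSpace ℝ (Fin 3), ‖ν‖ = 1 → ∀ ρ : ℝ, R ≤ ρ →
      ∀ X P : Finset (EuclideanSpace ℝ (Fin 3)),
      (∀ p ∈ X, ∀ q ∈ X, p ≠ q → 1 ≤ dist p q) → P ⊆ X →
      (∀ p, p ∈ P ↔ (p ∈ fccStacking 1 (Real.sqrt (2 / 3)) ∧ -(2 * R) ≤ ⟪p, ν⟫_ℝ ∧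
        ⟪p, ν⟫_ℝ ≤ -R ∧ ‖p‖ ^ 2 - ⟪p, ν⟫_ℝ ^ 2 ≤ ρ ^ 2)) →
      (∀ q ∈ X \ P, -R < ⟪q, ν⟫_ℝ) →
      (∃ (E : Finset (EuclideanSpace ℝ (Fin 3))) (w : EuclideanSpace ℝ (Fin 3) → EuclideanSpace ℝ (Fin 3) → ℝ),
        E ⊆ X \ P ∧ (E.card : ℝ) ≤ ρ ∧ (∀ x y, w x y = -w y x) ∧ (∀ x y, w x y ≤ 1) ∧
        ∀ q ∈ (X \ P) \ E,
          ((P.filter fun p => dist q p = 1 ∧ ∀ d ∈ U, ⟪p - q, d⟫_ℝ ≤ Real.sqrt 3 / 2).card : ℝ)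
            + (((X \ P).filter fun x => dist q x = 1 ∧ (∀ d ∈ U, ⟪x - q, d⟫_ℝ ≤ Real.sqrt 3 / 2) ∧
                ⟪x, ν⟫_ℝ < ⟪q, ν⟫_ℝ).card : ℝ)
            + (1 / 2) * (((X \ P).filter fun x => dist q x = 1 ∧ (∀ d ∈ U, ⟪x - q, d⟫_ℝ ≤ Real.sqrt 3 / 2) ∧
                ⟪x, ν⟫_ℝ = ⟪q, ν⟫_ℝ).card : ℝ)
            + ∑ x ∈ (X \ P).filter (fun x => dist q x = 1), w x q
          ≤ ((U.filter fun d => ⟪d, ν⟫_ℝ < 0 ∧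
                ∀ x ∈ X, dist q x = 1 → ⟪x - q, d⟫_ℝ ≤ Real.sqrt 3 / 2).card : ℝ)
            + (1 / 2) * ((U.filter fun d => ⟪d, ν⟫_ℝ = 0 ∧
                ∀ x ∈ X, dist q x = 1 → ⟪x - q, d⟫_ℝ ≤ Real.sqrt 3 / 2).card : ℝ)) →
      ((((P ×ˢ (X \ P)).filter fun pq => dist pq.1 pq.2 = 1).card : ℕ) : ℝ) ≤
        contactDeficiency (X \ P) + C * ρ := by
  classical
  obtain ⟨R, C, hR, hA⟩ := interstitialGain_slab
  refine ⟨R, C + 24, hR, ?_⟩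
  intro U hU hUneg hUcard ν hν ρ hρ X P hX hPX hP habove hrule
  obtain ⟨E, w, hE, hEcard, hw_anti, hw_le, hrule⟩ := hrule
  have h := hA U hU hUneg hUcard ν hν ρ hρ X P hX hPX hP habove
  set f : EuclideanSpace ℝ (Fin 3) → ℝ := fun q =>
    (((P.filter fun p => dist q p = 1 ∧ ∀ d ∈ U, ⟪p - q, d⟫_ℝ ≤ Real.sqrt 3 / 2).card : ℝ)
      + (((X \ P).filter fun x => dist q x = 1 ∧ (∀ d ∈ U, ⟪x - q, d⟫_ℝ ≤ Real.sqrt 3 / 2) ∧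
          ⟪x, ν⟫_ℝ < ⟪q, ν⟫_ℝ).card : ℝ)
      + (1 / 2) * (((X \ P).filter fun x => dist q x = 1 ∧ (∀ d ∈ U, ⟪x - q, d⟫_ℝ ≤ Real.sqrt 3 / 2) ∧
          ⟪x, ν⟫_ℝ = ⟪q, ν⟫_ℝ).card : ℝ)
      - ((U.filter fun d => ⟪d, ν⟫_ℝ < 0 ∧
          ∀ x ∈ X, dist q x = 1 → ⟪x - q, d⟫_ℝ ≤ Real.sqrt 3 / 2).card : ℝ)
      - (1 / 2) * ((U.filter fun d => ⟪d, ν⟫_ℝ = 0 ∧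
          ∀ x ∈ X, dist q x = 1 → ⟪x - q, d⟫_ℝ ≤ Real.sqrt 3 / 2).card : ℝ))
    with hf
  set s : EuclideanSpace ℝ (Fin 3) → ℝ := fun q => ∑ x ∈ (X \ P).filter (fun x => dist q x = 1), w x q with hs
  have hs0 : ∑ q ∈ X \ P, s q = 0 := sum_sum_realTransfer_eq_zero (X \ P) w hw_anti
  -- off the rim: `f q ≤ - s q`; on the rim: `f q ≤ 12` and `s q ≤ 12`
  have hoff : ∀ q ∈ (X \ P) \ E, f q ≤ -s q := fun q hq => by
    have := hrule q hq; simp only [hf, hs]; linarith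
  have hdeg : ∀ q, ((P.filter fun p => dist q p = 1).card : ℝ) + ((X \ P).filter fun x => dist q x = 1).card ≤ 12 := by
    intro q
    have h12 : ((X.filter fun x => dist q x = 1).card : ℝ) ≤ 12 := by exact_mod_cast card_partners_le_twelve X hX q
    have hsp : ((X.filter fun x => dist q x = 1).card : ℝ) =
        (P.filter fun p => dist q p = 1).card + ((X \ P).filter fun x => dist q x = 1).card := by
      exact_mod_cast card_partners_eq_plug_add_film X P hPX q
    linarith
  have hon : ∀ q ∈ E, f q ≤ 12 := by
    intro q _
    have h1 : (P.filter fun p => dist q p = 1 ∧ ∀ d ∈ U, ⟪p - q, d⟫_ℝ ≤ Real.sqrt 3 / 2).card ≤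
        (P.filter fun p => dist q p = 1).card := card_le_card (fun p hp => by
      rw [mem_filter] at hp ⊢; exact ⟨hp.1, hp.2.1⟩)
    have h23 : ((X \ P).filter fun x => dist q x = 1 ∧ (∀ d ∈ U, ⟪x - q, d⟫_ℝ ≤ Real.sqrt 3 / 2) ∧
          ⟪x, ν⟫_ℝ < ⟪q, ν⟫_ℝ).card +
        ((X \ P).filter fun x => dist q x = 1 ∧ (∀ d ∈ U, ⟪x - q, d⟫_ℝ ≤ Real.sqrt 3 / 2) ∧
          ⟪x, ν⟫_ℝ = ⟪q, ν⟫_ℝ).card ≤ ((X \ P).filter fun x => dist q x = 1).card := by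
      rw [← card_union_of_disjoint]
      · refine card_le_card fun x hx => ?_
        rw [mem_union, mem_filter, mem_filter] at hx
        rw [mem_filter]
        rcases hx with hx | hx
        · exact ⟨hx.1, hx.2.1⟩
        · exact ⟨hx.1, hx.2.1⟩
      · exact disjoint_filter.2 fun x _ h1 h2 => absurd h2.2.2 h1.2.2.ne
    have e1 : ((P.filter fun p => dist q p = 1 ∧ ∀ d ∈ U, ⟪p - q, d⟫_ℝ ≤ Real.sqrt 3 / 2).card : ℝ) ≤
        (P.filter fun p => dist q p = 1).card := by exact_mod_cast h1
    have e23 : (((X \ P).filter fun x => dist q x = 1 ∧ (∀ d ∈ U, ⟪x - q, d⟫_ℝ ≤ Real.sqrt 3 / 2) ∧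
          ⟪x, ν⟫_ℝ < ⟪q, ν⟫_ℝ).card : ℝ) +
        (((X \ P).filter fun x => dist q x = 1 ∧ (∀ d ∈ U, ⟪x - q, d⟫_ℝ ≤ Real.sqrt 3 / 2) ∧
          ⟪x, ν⟫_ℝ = ⟪q, ν⟫_ℝ).card : ℝ) ≤ ((X \ P).filter fun x => dist q x = 1).card := by exact_mod_cast h23
    have e4 := hdeg q
    simp only [hf]
    nlinarith [e1, e23, e4,
      Nat.cast_nonneg (α := ℝ) ((U.filter fun d => ⟪d, ν⟫_ℝ < 0 ∧
        ∀ x ∈ X, dist q x = 1 → ⟪x - q, d⟫_ℝ ≤ Real.sqrt 3 / 2).card),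
      Nat.cast_nonneg (α := ℝ) ((U.filter fun d => ⟪d, ν⟫_ℝ = 0 ∧
        ∀ x ∈ X, dist q x = 1 → ⟪x - q, d⟫_ℝ ≤ Real.sqrt 3 / 2).card),
      Nat.cast_nonneg (α := ℝ) (((X \ P).filter fun x => dist q x = 1 ∧
        (∀ d ∈ U, ⟪x - q, d⟫_ℝ ≤ Real.sqrt 3 / 2) ∧ ⟪x, ν⟫_ℝ = ⟪q, ν⟫_ℝ).card)]
  have hson : ∀ q ∈ E, s q ≤ 12 := by
    intro q _
    simp only [hs]
    have h1 : ∑ x ∈ (X \ P).filter (fun x => dist q x = 1), w x q ≤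
        ∑ x ∈ (X \ P).filter (fun x => dist q x = 1), (1 : ℝ) := sum_le_sum fun x _ => hw_le x q
    rw [sum_const, nsmul_eq_mul, mul_one] at h1
    linarith [hdeg q, Nat.cast_nonneg (α := ℝ) (P.filter fun p => dist q p = 1).card]
  have hsum : ∑ q ∈ X \ P, f q ≤ 24 * ρ := by
    rw [← sum_sdiff hE]
    have hs0' : ∑ q ∈ (X \ P) \ E, s q + ∑ q ∈ E, s q = 0 := by rw [sum_sdiff hE]; exact hs0
    have h1 : ∑ q ∈ (X \ P) \ E, f q ≤ ∑ q ∈ (X \ P) \ E, (-s q) := sum_le_sum hoff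
    rw [sum_neg_distrib] at h1
    have h2 : ∑ q ∈ E, f q ≤ ∑ q ∈ E, (12 : ℝ) := sum_le_sum hon
    have h3 : ∑ q ∈ E, s q ≤ ∑ q ∈ E, (12 : ℝ) := sum_le_sum hson
    rw [sum_const, nsmul_eq_mul] at h2 h3
    nlinarith
  have hf' : ∑ q ∈ X \ P, f q = ∑ q ∈ X \ P,
      (((P.filter fun p => dist q p = 1 ∧ ∀ d ∈ U, ⟪p - q, d⟫_ℝ ≤ Real.sqrt 3 / 2).card : ℝ)
        + (((X \ P).filter fun x => dist q x = 1 ∧ (∀ d ∈ U, ⟪x - q, d⟫_ℝ ≤ Real.sqrt 3 / 2) ∧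
            ⟪x, ν⟫_ℝ < ⟪q, ν⟫_ℝ).card : ℝ)
        + (1 / 2) * (((X \ P).filter fun x => dist q x = 1 ∧ (∀ d ∈ U, ⟪x - q, d⟫_ℝ ≤ Real.sqrt 3 / 2) ∧
            ⟪x, ν⟫_ℝ = ⟪q, ν⟫_ℝ).card : ℝ)
        - ((U.filter fun d => ⟪d, ν⟫_ℝ < 0 ∧
            ∀ x ∈ X, dist q x = 1 → ⟪x - q, d⟫_ℝ ≤ Real.sqrt 3 / 2).card : ℝ)
        - (1 / 2) * ((U.filter fun d => ⟪d, ν⟫_ℝ = 0 ∧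
            ∀ x ∈ X, dist q x = 1 → ⟪x - q, d⟫_ℝ ≤ Real.sqrt 3 / 2).card : ℝ)) := rfl
  rw [hf'] at hsum
  linarith

end Summit.Ventures.Crystal3D.Theorems

end
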